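import Summits.QuantumFields.BalabanUV.Beta.RemainderExplicitMarkovRate

/-!
# `BalabanUV.Beta.GAN24.DerivativeRateTransferAnalytic` — binder row G-an2-4 ∕ (CONV-C), route R6 «VALUES, NOT DERIVATIVES», PART 7:
# THE ANALYTIC TRANSFER — a VALUE-LEVEL rate on a REAL background segment + holomorphy with ONE uniform bound on a complex
# neighbourhood ⇒ the DERIVATIVE at the base point inherits the rate with exponent `θ^{1−r}` for EVERY `r ∈ ]0, 1]` (no halving in the
# limit `r → 0`), and in the form `ε·log(B∕ε)²` (ratio `θ` up to `k²`) — steps S3′ ∕ S4′ of ROUTES-GAN24 v26 «R6 — v26 NOTE» made kernel,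
# over co-owner beta-d4-p3's engine `RemainderExplicitMarkovRate` BY NAME (unit b2b-balaban-gan24-p3, gen 33; v1)

NOT IN PRINT; OUR PROOF (for the ROUTE; [folklore] complex analysis — beta-d4-p3's `RemainderExplicitMarkovRate.norm_deriv_le_of_segment` ∕
`norm_deriv_le_log_sq` (p308106 ✓; three lines at the tip of a slit + Cauchy) BY NAME, Mathlib's Cauchy estimate, the triangle inequality).  HONEST FRAMING (cell contract, verbatim): «discharging `BetaPertH` makes Bałaban's UV stability UNCONDITIONAL — a real
constructive-QFT result; it is NOT the continuum limit and NOT the Clay problem.»  HONEST DEPENDENCY (verbatim): «continuum YM on T⁴ ⇐ BetaPertH ∧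
nine spine estimates (0/9 proved); BetaPertH ⇐ (D1) ∧ (D4) ∧ CAP+tail; G-an2-4 gates asym, D1 and NE2/3/4.»

WHY THIS FILE.  PART 1 (`GAN24.DerivativeRateTransfer`, p257089) transferred a value rate `|F_{k+1}(s) − F_k(s)| ≤ Cθ^k` on a REAL interval to the
`s`-derivative at `0` by Landau–Kolmogorov against a REAL Taylor bound one order up (R6-S3), at the price `θ ↦ √θ` (first order), `θ^{1∕3}` (second).
ROUTES-GAN24 v26 «R6 — v26 NOTE» (gan24-idea-1 g27, answering this lineage's `R6-KING432-READING.md`) replaces S3 by S3′ = ANALYTICITY in the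
complex background parameter with ONE uniform bound — the printed KIND of input ([Balaban1985BackgroundPropagators] Thm 3.4, p. 400: the
background-field operators «extend to configurations … as analytic functions … [and] satisfy all the inequalities»; CONTEXT only, nothing printed is
used) — and S4 by S4′ = two constants + Cauchy (the note's own engine: the disc∕diameter form `Literature.Analysis.Complex.TwoConstantsDisc`, interior
point, one log; this file uses the SEGMENT-TIP form already joined to Cauchy in the tree — one-sided segment, log²; either serves ∃θ).  THIS FILE is S4′ for entry families `F k : ℂ → ℂ` holomorphic on `ball 0 ρ` with `‖F k‖ ≤ B` and a
value rate `c·θ^k` on the real segment `[0, s₁]` (`s₁·cosh 1 < ρ`; ONE-SIDED suffices — the tip estimate): the derivative rows at the base point inherit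
S1's exponent up to `θ^{−r}` (every `r ∈ ]0,1]`), resp. up to `k²` (log form), and the second-derivative rows up to `θ^{−2r+r²}` — no roots.

WHAT THIS FILE PROVES (0 sorry, 0 `def`):
* §1 `transferω` ∕ `transferω_log` — two members: `F_i` holomorphic with `‖F_i‖ ≤ B` on `ball 0 ρ`, `‖F₁ s − F₀ s‖ ≤ ε` on `[0, s₁]`, `0 < ε` ⇒
  `‖deriv F₁ 0 − deriv F₀ 0‖ ≤ 25·(min ε (2B))^{1−r}·(2B)^r∕(s₁r²)` (every `r ∈ ]0,1]`) and `≤ (25e²∕(4s₁))·m·max(log(2B∕m), 2)²`, `m = min ε (2B)`;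
* §2 the FAMILY form: `deriv_step_rateω` (`‖deriv (F (k+1)) 0 − deriv (F k) 0‖ ≤ 25·(2B)^r∕(s₁r²)·c^{1−r}·(θ^{1−r})^k`), `deriv_step_rateω_log`, and
  `exists_deriv_geometricRate` (`∃ c′ θ′, 0 ≤ c′ ∧ 0 ≤ θ′ ∧ θ′ < 1 ∧ ∀ k, ‖…‖ ≤ c′·θ′^k`) — the one-step-rate clause in the ∃θ-currency;
* §3 SECOND ORDER by ITERATION: `norm_deriv_le_on_half_segment` (the engine on the translate `z ↦ g (z+s)`, `s ∈ [0, s₁∕2]`), `norm_deriv_le_inner`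
  (Cauchy: `‖g′‖ ≤ 2B∕(ρ−ρ₁)` on `ball 0 ρ₁`), **`norm_deriv_deriv_le_of_segment`** (`‖g″(0)‖ ≤ 25·(min ε′ B″)^{1−r′}·B″^{r′}∕((s₁∕2)r′²)`,
  `ε′ = 25ε^{1−r}B^r∕((s₁∕2)r²)`, `B″ = 2B∕(ρ − s₁cosh 1)`); §4 the family form **`deriv₂_step_rateω`** (exponent `(θ^{1−r})^{1−r}` — PART 3's
  `transfer₂` was stuck at `θ^{1∕3}`) and `exists_deriv₂_geometricRate`.
WHAT IT DOES NOT DO: supply S1 (the value rate WITH BACKGROUND — the route's one open input, = NE2-P2's with-background END), S2 (the Bałaban-instance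
dictionary), the decay clause (PART 4's `decay_interp` pattern applies verbatim), MIXED derivatives `∂_s∂_t` (two complex parameters — not typed in v1),
or any instantiation on Bałaban's objects.  SUPPLIER work on route R6 (rank 2, «R6 → p2∕p3 lineages as
REDUCTION», no seat); no consumer of record; NOT one of the nine spine estimates; NEVER «G-an2-4 closed»; NOT (CONV-C), NOT D1, NOT `BetaPertH`,
NOT continuum, NOT Clay.  Records: `HOME/b2b-balaban-gan24-p3/WOODBURY-FIBRE.md` v13.3, `HOME/beta/ROUTES-GAN24.md` v26 «R6 — v26 NOTE» (gan24-idea-1 g27,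
whose `TransferInputω` shape this is, with credit), `HOME/b2b-balaban-gan24-p3/gen33/reading/R6-KING432-READING.md`.
-/

noncomputable section
open Set Metric

namespace Summit.QuantumFields.BalabanUV.Beta.GAN24.DerivativeRateTransferAnalytic

open Summit.QuantumFields.BalabanUV.Beta.RemainderExplicitMarkovRate (norm_deriv_le_of_segment norm_deriv_le_log_sq)

/-! ## §1 Two members: the analytic transfer of a value difference to the derivative at the base point -/

section TwoMembers

variable {F₀ F₁ : ℂ → ℂ} {ρ s₁ ε B : ℝ}

/-- [folklore] `0 < ρ` from `0 < s₁` and `s₁·cosh 1 < ρ`. -/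
theorem rho_pos (hs₁ : 0 < s₁) (hs₁ρ : s₁ * Real.cosh 1 < ρ) : 0 < ρ :=
  (mul_pos hs₁ (lt_of_lt_of_le one_pos (Real.one_le_cosh 1))).trans hs₁ρ

/-- [folklore] the difference of two functions holomorphic on the ball is holomorphic, bounded by `2B`, and its derivative at `0` is the
difference of the derivatives. -/
theorem deriv_sub_at_zero (hs₁ : 0 < s₁) (hs₁ρ : s₁ * Real.cosh 1 < ρ)
    (h₀ : DifferentiableOn ℂ F₀ (ball (0 : ℂ) ρ)) (h₁ : DifferentiableOn ℂ F₁ (ball (0 : ℂ) ρ)) :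
    deriv (fun z => F₁ z - F₀ z) 0 = deriv F₁ 0 - deriv F₀ 0 := by
  have hρ : 0 < ρ := rho_pos hs₁ hs₁ρ
  have hmem : ball (0 : ℂ) ρ ∈ nhds (0 : ℂ) := ball_mem_nhds 0 hρ
  exact deriv_sub (h₁.differentiableAt hmem) (h₀.differentiableAt hmem)

/-- **`transferω` — THE ANALYTIC TRANSFER, EVERY RADIUS EXPONENT** [our proof over beta-d4-p3's engine]: `F₀, F₁` holomorphic on `ball 0 ρ` with
`‖F_i‖ ≤ B` there, `‖F₁ s − F₀ s‖ ≤ ε` for real `s ∈ [0, s₁]`, `0 < ε`, `0 < s₁`, `s₁·cosh 1 < ρ`: for every `r ∈ ]0, 1]`,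
`‖deriv F₁ 0 − deriv F₀ 0‖ ≤ 25 · (min ε (2B))^{1−r} · (2B)^r ∕ (s₁ · r²)`. -/
theorem transferω (hs₁ : 0 < s₁) (hs₁ρ : s₁ * Real.cosh 1 < ρ)
    (h₀ : DifferentiableOn ℂ F₀ (ball (0 : ℂ) ρ)) (h₁ : DifferentiableOn ℂ F₁ (ball (0 : ℂ) ρ))
    (hB₀ : ∀ z ∈ ball (0 : ℂ) ρ, ‖F₀ z‖ ≤ B) (hB₁ : ∀ z ∈ ball (0 : ℂ) ρ, ‖F₁ z‖ ≤ B)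
    (hε : ∀ s : ℝ, 0 ≤ s → s ≤ s₁ → ‖F₁ (s : ℂ) - F₀ (s : ℂ)‖ ≤ ε) (hε0 : 0 < ε)
    {r : ℝ} (hr : 0 < r) (hr1 : r ≤ 1) :
    ‖deriv F₁ 0 - deriv F₀ 0‖ ≤ 25 * ((min ε (2 * B)) ^ (1 - r) * (2 * B) ^ r) / (s₁ * r ^ 2) := by
  have hρ : 0 < ρ := rho_pos hs₁ hs₁ρ
  -- `‖F₀ 0‖ ≤ B` gives `0 ≤ B`; the engine needs `0 < min ε (2B)`, so we split on `B = 0` (then everything vanishes) vs `0 < B`.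
  have hB0 : 0 ≤ B := (norm_nonneg _).trans (hB₀ 0 (mem_ball_self hρ))
  have hg : DifferentiableOn ℂ (fun z => F₁ z - F₀ z) (ball (0 : ℂ) ρ) := h₁.sub h₀
  have hgB : ∀ z ∈ ball (0 : ℂ) ρ, ‖F₁ z - F₀ z‖ ≤ 2 * B := fun z hz =>
    (norm_sub_le _ _).trans (by linarith [hB₀ z hz, hB₁ z hz])
  rcases eq_or_lt_of_le hB0 with hBz | hBpos
  · -- `B = 0`: both functions vanish on the ball, so do their derivatives at `0`
    have hz₀ : ∀ z ∈ ball (0 : ℂ) ρ, F₀ z = 0 := fun z hz => norm_le_zero_iff.1 (by simpa [← hBz] using hB₀ z hz)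
    have hz₁ : ∀ z ∈ ball (0 : ℂ) ρ, F₁ z = 0 := fun z hz => norm_le_zero_iff.1 (by simpa [← hBz] using hB₁ z hz)
    have hd₀ : deriv F₀ 0 = 0 := by
      rw [← derivWithin_of_isOpen isOpen_ball (mem_ball_self hρ)]
      rw [derivWithin_congr (f := fun _ => (0 : ℂ)) (fun z hz => hz₀ z hz) (hz₀ 0 (mem_ball_self hρ))]
      simp
    have hd₁ : deriv F₁ 0 = 0 := by
      rw [← derivWithin_of_isOpen isOpen_ball (mem_ball_self hρ)]
      rw [derivWithin_congr (f := fun _ => (0 : ℂ)) (fun z hz => hz₁ z hz) (hz₁ 0 (mem_ball_self hρ))]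
      simp
    rw [hd₀, hd₁, sub_zero, norm_zero]
    positivity
  · have hε' : ∀ s : ℝ, 0 ≤ s → s ≤ s₁ → ‖F₁ (s : ℂ) - F₀ (s : ℂ)‖ ≤ min ε (2 * B) := fun s hs0 hs1 =>
      le_min (hε s hs0 hs1) (hgB _ (by
        rw [mem_ball_zero_iff, Complex.norm_real, Real.norm_eq_abs, abs_of_nonneg hs0]
        have : s₁ ≤ s₁ * Real.cosh 1 := le_mul_of_one_le_right hs₁.le (Real.one_le_cosh 1)
        linarith))
    have hmin0 : 0 < min ε (2 * B) := lt_min hε0 (by linarith)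
    have hminB : min ε (2 * B) ≤ 2 * B := min_le_right _ _
    have key := norm_deriv_le_of_segment (g := fun z => F₁ z - F₀ z) hg hgB hε' hs₁ hs₁ρ hmin0 hminB hr hr1
    rwa [deriv_sub_at_zero hs₁ hs₁ρ h₀ h₁] at key

/-- **`transferω_log` — THE SAME WITH THE SQUARE OF THE LOGARITHM** (ratio `ε` itself up to `log(2B∕ε)²`): under the hypotheses of `transferω`,
`‖deriv F₁ 0 − deriv F₀ 0‖ ≤ (25·e²∕(4s₁)) · m · max(log(2B∕m), 2)²`, `m := min ε (2B)`. -/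
theorem transferω_log (hs₁ : 0 < s₁) (hs₁ρ : s₁ * Real.cosh 1 < ρ)
    (h₀ : DifferentiableOn ℂ F₀ (ball (0 : ℂ) ρ)) (h₁ : DifferentiableOn ℂ F₁ (ball (0 : ℂ) ρ))
    (hB₀ : ∀ z ∈ ball (0 : ℂ) ρ, ‖F₀ z‖ ≤ B) (hB₁ : ∀ z ∈ ball (0 : ℂ) ρ, ‖F₁ z‖ ≤ B)
    (hε : ∀ s : ℝ, 0 ≤ s → s ≤ s₁ → ‖F₁ (s : ℂ) - F₀ (s : ℂ)‖ ≤ ε) (hε0 : 0 < ε) :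
    ‖deriv F₁ 0 - deriv F₀ 0‖ ≤
      25 * Real.exp 2 / (4 * s₁) * min ε (2 * B) * max (Real.log (2 * B / min ε (2 * B))) 2 ^ 2 := by
  have hρ : 0 < ρ := rho_pos hs₁ hs₁ρ
  have hB0 : 0 ≤ B := (norm_nonneg _).trans (hB₀ 0 (mem_ball_self hρ))
  have hg : DifferentiableOn ℂ (fun z => F₁ z - F₀ z) (ball (0 : ℂ) ρ) := h₁.sub h₀
  have hgB : ∀ z ∈ ball (0 : ℂ) ρ, ‖F₁ z - F₀ z‖ ≤ 2 * B := fun z hz =>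
    (norm_sub_le _ _).trans (by linarith [hB₀ z hz, hB₁ z hz])
  rcases eq_or_lt_of_le hB0 with hBz | hBpos
  · have hz₀ : ∀ z ∈ ball (0 : ℂ) ρ, F₀ z = 0 := fun z hz => norm_le_zero_iff.1 (by simpa [← hBz] using hB₀ z hz)
    have hz₁ : ∀ z ∈ ball (0 : ℂ) ρ, F₁ z = 0 := fun z hz => norm_le_zero_iff.1 (by simpa [← hBz] using hB₁ z hz)
    have hd₀ : deriv F₀ 0 = 0 := by
      rw [← derivWithin_of_isOpen isOpen_ball (mem_ball_self hρ)]
      rw [derivWithin_congr (f := fun _ => (0 : ℂ)) (fun z hz => hz₀ z hz) (hz₀ 0 (mem_ball_self hρ))]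
      simp
    have hd₁ : deriv F₁ 0 = 0 := by
      rw [← derivWithin_of_isOpen isOpen_ball (mem_ball_self hρ)]
      rw [derivWithin_congr (f := fun _ => (0 : ℂ)) (fun z hz => hz₁ z hz) (hz₁ 0 (mem_ball_self hρ))]
      simp
    rw [hd₀, hd₁, sub_zero, norm_zero]
    have : 0 ≤ min ε (2 * B) := le_min hε0.le (by linarith); positivity
  · have hε' : ∀ s : ℝ, 0 ≤ s → s ≤ s₁ → ‖F₁ (s : ℂ) - F₀ (s : ℂ)‖ ≤ min ε (2 * B) := fun s hs0 hs1 =>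
      le_min (hε s hs0 hs1) (hgB _ (by
        rw [mem_ball_zero_iff, Complex.norm_real, Real.norm_eq_abs, abs_of_nonneg hs0]
        have : s₁ ≤ s₁ * Real.cosh 1 := le_mul_of_one_le_right hs₁.le (Real.one_le_cosh 1)
        linarith))
    have hmin0 : 0 < min ε (2 * B) := lt_min hε0 (by linarith)
    have hminB : min ε (2 * B) ≤ 2 * B := min_le_right _ _
    have key := norm_deriv_le_log_sq (g := fun z => F₁ z - F₀ z) hg hgB hε' hs₁ hs₁ρ hmin0 hminB
    rwa [deriv_sub_at_zero hs₁ hs₁ρ h₀ h₁] at key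

end TwoMembers

/-! ## §2 The family form: a geometric VALUE rate on the segment gives a geometric DERIVATIVE rate at the base point, exponent `θ^{1−r}` -/

section Family

variable {F : ℕ → ℂ → ℂ} {ρ s₁ B c θ : ℝ}

/-- [folklore] rpow bookkeeping: `(c·θ^k)^{1−r} = c^{1−r}·(θ^{1−r})^k` for `0 ≤ c`, `0 ≤ θ`. -/
theorem rpow_geom (hc : 0 ≤ c) (hθ : 0 ≤ θ) (r : ℝ) (k : ℕ) :
    (c * θ ^ k) ^ (1 - r) = c ^ (1 - r) * (θ ^ (1 - r)) ^ k := by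
  rw [Real.mul_rpow hc (pow_nonneg hθ k), ← Real.rpow_natCast (θ ^ (1 - r)) k, ← Real.rpow_mul hθ,
    mul_comm (1 - r) (k : ℝ), Real.rpow_mul hθ, Real.rpow_natCast]

/-- **`deriv_step_rateω` — THE DERIVATIVE ROW INHERITS THE VALUE RATE WITH EXPONENT `θ^{1−r}`** [our proof]: `F k` holomorphic on `ball 0 ρ` with
`‖F k z‖ ≤ B` (all `k`), value rate `‖F (k+1) s − F k s‖ ≤ c·θ^k` on the real segment `[0, s₁]` with `0 < c`, `0 < θ`, and `0 < s₁`, `s₁·cosh 1 < ρ`: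
for every `r ∈ ]0, 1]` and every `k`, `‖deriv (F (k+1)) 0 − deriv (F k) 0‖ ≤ 25·(2B)^r∕(s₁r²) · c^{1−r} · (θ^{1−r})^k`. -/
theorem deriv_step_rateω (hs₁ : 0 < s₁) (hs₁ρ : s₁ * Real.cosh 1 < ρ)
    (hF : ∀ k, DifferentiableOn ℂ (F k) (ball (0 : ℂ) ρ)) (hB : ∀ k, ∀ z ∈ ball (0 : ℂ) ρ, ‖F k z‖ ≤ B)
    (hrate : ∀ k (s : ℝ), 0 ≤ s → s ≤ s₁ → ‖F (k + 1) (s : ℂ) - F k (s : ℂ)‖ ≤ c * θ ^ k) (hc : 0 < c) (hθ : 0 < θ)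
    {r : ℝ} (hr : 0 < r) (hr1 : r ≤ 1) (k : ℕ) :
    ‖deriv (F (k + 1)) 0 - deriv (F k) 0‖ ≤ 25 * (2 * B) ^ r / (s₁ * r ^ 2) * c ^ (1 - r) * (θ ^ (1 - r)) ^ k := by
  have hρ : 0 < ρ := rho_pos hs₁ hs₁ρ
  have hB0 : 0 ≤ B := (norm_nonneg _).trans (hB 0 0 (mem_ball_self hρ))
  have hεk : 0 < c * θ ^ k := mul_pos hc (pow_pos hθ k)
  have key := transferω hs₁ hs₁ρ (hF k) (hF (k + 1)) (hB k) (hB (k + 1)) (hrate k) hεk hr hr1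
  refine key.trans ?_
  -- `(min (cθ^k) (2B))^{1−r} ≤ (cθ^k)^{1−r} = c^{1−r}·(θ^{1−r})^k`
  have hmono : (min (c * θ ^ k) (2 * B)) ^ (1 - r) ≤ (c * θ ^ k) ^ (1 - r) :=
    Real.rpow_le_rpow (le_min hεk.le (by linarith)) (min_le_left _ _) (by linarith)
  have h2B : 0 ≤ (2 * B) ^ r := Real.rpow_nonneg (by linarith) r
  calc 25 * ((min (c * θ ^ k) (2 * B)) ^ (1 - r) * (2 * B) ^ r) / (s₁ * r ^ 2)
      ≤ 25 * ((c * θ ^ k) ^ (1 - r) * (2 * B) ^ r) / (s₁ * r ^ 2) := by gcongr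
    _ = 25 * (2 * B) ^ r / (s₁ * r ^ 2) * c ^ (1 - r) * (θ ^ (1 - r)) ^ k := by rw [rpow_geom hc.le hθ.le r k]; ring

/-- **`exists_deriv_geometricRate` — THE ∃θ-CURRENCY END** [our proof]: under the hypotheses of `deriv_step_rateω` (with `θ < 1`), the derivative row
at the base point has a geometric one-step rate: `∃ c′ θ′, 0 ≤ c′ ∧ 0 ≤ θ′ ∧ θ′ < 1 ∧ ∀ k, ‖deriv (F (k+1)) 0 − deriv (F k) 0‖ ≤ c′·θ′^k`
(witness `θ′ = θ^{1∕2}` from `r = 1∕2`; any `θ^{1−r}`, `r ∈ ]0,1]`, is available from `deriv_step_rateω`). -/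
theorem exists_deriv_geometricRate (hs₁ : 0 < s₁) (hs₁ρ : s₁ * Real.cosh 1 < ρ)
    (hF : ∀ k, DifferentiableOn ℂ (F k) (ball (0 : ℂ) ρ)) (hB : ∀ k, ∀ z ∈ ball (0 : ℂ) ρ, ‖F k z‖ ≤ B)
    (hrate : ∀ k (s : ℝ), 0 ≤ s → s ≤ s₁ → ‖F (k + 1) (s : ℂ) - F k (s : ℂ)‖ ≤ c * θ ^ k) (hc : 0 < c) (hθ : 0 < θ) (hθ1 : θ < 1) :
    ∃ c' θ' : ℝ, 0 ≤ c' ∧ 0 ≤ θ' ∧ θ' < 1 ∧ ∀ k, ‖deriv (F (k + 1)) 0 - deriv (F k) 0‖ ≤ c' * θ' ^ k := by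
  have hρ : 0 < ρ := rho_pos hs₁ hs₁ρ
  have hB0 : 0 ≤ B := (norm_nonneg _).trans (hB 0 0 (mem_ball_self hρ))
  refine ⟨25 * (2 * B) ^ (1 / 2 : ℝ) / (s₁ * (1 / 2 : ℝ) ^ 2) * c ^ (1 - 1 / 2 : ℝ), θ ^ (1 - 1 / 2 : ℝ), ?_, ?_, ?_, fun k => ?_⟩
  · have : 0 ≤ (2 * B) ^ (1 / 2 : ℝ) := Real.rpow_nonneg (by linarith) _
    have : 0 ≤ c ^ (1 - 1 / 2 : ℝ) := Real.rpow_nonneg hc.le _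
    positivity
  · exact Real.rpow_nonneg hθ.le _
  · exact Real.rpow_lt_one hθ.le hθ1 (by norm_num)
  · exact deriv_step_rateω hs₁ hs₁ρ hF hB hrate hc hθ (by norm_num) (by norm_num) k

/-- **`deriv_step_rateω_log` — THE LOG-SQUARED FORM** [our proof]: with `ε_k := min (c·θ^k) (2B)`,
`‖deriv (F (k+1)) 0 − deriv (F k) 0‖ ≤ (25e²∕(4s₁)) · ε_k · max(log(2B∕ε_k), 2)²` — ratio `θ` up to the square of `k·log θ⁻¹ + log(2B∕c)`. -/
theorem deriv_step_rateω_log (hs₁ : 0 < s₁) (hs₁ρ : s₁ * Real.cosh 1 < ρ)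
    (hF : ∀ k, DifferentiableOn ℂ (F k) (ball (0 : ℂ) ρ)) (hB : ∀ k, ∀ z ∈ ball (0 : ℂ) ρ, ‖F k z‖ ≤ B)
    (hrate : ∀ k (s : ℝ), 0 ≤ s → s ≤ s₁ → ‖F (k + 1) (s : ℂ) - F k (s : ℂ)‖ ≤ c * θ ^ k) (hc : 0 < c) (hθ : 0 < θ) (k : ℕ) :
    ‖deriv (F (k + 1)) 0 - deriv (F k) 0‖ ≤
      25 * Real.exp 2 / (4 * s₁) * min (c * θ ^ k) (2 * B) * max (Real.log (2 * B / min (c * θ ^ k) (2 * B))) 2 ^ 2 :=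
  transferω_log hs₁ hs₁ρ (hF k) (hF (k + 1)) (hB k) (hB (k + 1)) (hrate k) (mul_pos hc (pow_pos hθ k))

end Family

/-! ## §3 Second order: the same estimate ITERATED on the translated half-segment (exponent `(1−r)·(1−r′)`, no cube root) -/

section SecondOrder

variable {g : ℂ → ℂ} {ρ s₁ ε B : ℝ}

/-- [folklore] `s₁·(cosh 1 + 1)∕2 ≤ s₁·cosh 1`, so the half-segment translated by `s ≤ s₁∕2` still fits: `(s₁∕2)·cosh 1 < ρ − s₁∕2`. -/
theorem half_fits (hs₁ : 0 < s₁) (hs₁ρ : s₁ * Real.cosh 1 < ρ) : s₁ / 2 * Real.cosh 1 < ρ - s₁ / 2 := by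
  nlinarith [Real.one_le_cosh 1]

/-- **FIRST DERIVATIVE ALONG THE HALF-SEGMENT** [our proof over beta-d4-p3's engine, translated]: `g` holomorphic on `ball 0 ρ`, `‖g‖ ≤ B` there,
`‖g s‖ ≤ ε` on `[0, s₁]`, `0 < ε ≤ B`, `s₁·cosh 1 < ρ`: for every real `s ∈ [0, s₁∕2]` and every `r ∈ ]0,1]`,
`‖deriv g s‖ ≤ 25·ε^{1−r}·B^r ∕ ((s₁∕2)·r²)` (the engine applied to `z ↦ g (z + s)` on `ball 0 (ρ − s₁∕2)` with the segment `[0, s₁∕2]`). -/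
theorem norm_deriv_le_on_half_segment (hg : DifferentiableOn ℂ g (ball (0 : ℂ) ρ)) (hB : ∀ z ∈ ball (0 : ℂ) ρ, ‖g z‖ ≤ B)
    (hε : ∀ s : ℝ, 0 ≤ s → s ≤ s₁ → ‖g (s : ℂ)‖ ≤ ε) (hs₁ : 0 < s₁) (hs₁ρ : s₁ * Real.cosh 1 < ρ) (hε0 : 0 < ε) (hεB : ε ≤ B)
    {r : ℝ} (hr : 0 < r) (hr1 : r ≤ 1) {s : ℝ} (hs0 : 0 ≤ s) (hs : s ≤ s₁ / 2) :
    ‖deriv g (s : ℂ)‖ ≤ 25 * (ε ^ (1 - r) * B ^ r) / (s₁ / 2 * r ^ 2) := by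
  -- the translate `gₛ z := g (z + s)`
  have hmaps : ∀ z ∈ ball (0 : ℂ) (ρ - s₁ / 2), z + (s : ℂ) ∈ ball (0 : ℂ) ρ := by
    intro z hz
    rw [mem_ball_zero_iff] at hz ⊢
    calc ‖z + (s : ℂ)‖ ≤ ‖z‖ + ‖(s : ℂ)‖ := norm_add_le _ _
      _ < (ρ - s₁ / 2) + s₁ / 2 := by
          rw [Complex.norm_real, Real.norm_eq_abs, abs_of_nonneg hs0]; linarith
      _ = ρ := by ring
  have hgs : DifferentiableOn ℂ (fun z => g (z + (s : ℂ))) (ball (0 : ℂ) (ρ - s₁ / 2)) :=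
    hg.comp ((differentiableOn_id).add_const _) hmaps
  have hBs : ∀ z ∈ ball (0 : ℂ) (ρ - s₁ / 2), ‖g (z + (s : ℂ))‖ ≤ B := fun z hz => hB _ (hmaps z hz)
  have hεs : ∀ t : ℝ, 0 ≤ t → t ≤ s₁ / 2 → ‖g ((t : ℂ) + (s : ℂ))‖ ≤ ε := by
    intro t ht0 ht
    have e : (t : ℂ) + (s : ℂ) = ((t + s : ℝ) : ℂ) := by push_cast; ring
    rw [e]
    exact hε (t + s) (by linarith) (by linarith)
  have key := norm_deriv_le_of_segment (g := fun z => g (z + (s : ℂ))) hgs hBs hεs (half_pos hs₁) (half_fits hs₁ hs₁ρ) hε0 hεB hr hr1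
  rwa [deriv_comp_add_const, zero_add] at key

/-- [folklore] **CAUCHY BOUND FOR THE DERIVATIVE ON THE INNER BALL**: `g` holomorphic on `ball 0 ρ` with `‖g‖ ≤ B`, `0 < ρ₁ < ρ`:
`‖deriv g z‖ ≤ 2B∕(ρ − ρ₁)` on `ball 0 ρ₁` (Mathlib `Complex.norm_deriv_le_of_forall_mem_sphere_norm_le` on the circle of radius `(ρ − ρ₁)∕2`). -/
theorem norm_deriv_le_inner (hg : DifferentiableOn ℂ g (ball (0 : ℂ) ρ)) (hB : ∀ z ∈ ball (0 : ℂ) ρ, ‖g z‖ ≤ B)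
    {ρ₁ : ℝ} (hρ₁ : ρ₁ < ρ) {z : ℂ} (hz : z ∈ ball (0 : ℂ) ρ₁) :
    ‖deriv g z‖ ≤ 2 * B / (ρ - ρ₁) := by
  have hR : 0 < (ρ - ρ₁) / 2 := by linarith
  have hsub : closedBall z ((ρ - ρ₁) / 2) ⊆ ball (0 : ℂ) ρ := by
    intro w hw
    rw [mem_closedBall] at hw
    rw [mem_ball_zero_iff] at hz ⊢
    calc ‖w‖ = ‖(w - z) + z‖ := by rw [sub_add_cancel]
      _ ≤ ‖w - z‖ + ‖z‖ := norm_add_le _ _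
      _ < (ρ - ρ₁) / 2 + ρ₁ := by rw [← dist_eq_norm]; linarith
      _ ≤ ρ := by linarith
  have hd : DiffContOnCl ℂ g (ball z ((ρ - ρ₁) / 2)) :=
    DifferentiableOn.diffContOnCl (by rw [closure_ball z hR.ne']; exact hg.mono hsub)
  have hC : ∀ w ∈ sphere z ((ρ - ρ₁) / 2), ‖g w‖ ≤ B := fun w hw => hB w (hsub (sphere_subset_closedBall hw))
  have key := Complex.norm_deriv_le_of_forall_mem_sphere_norm_le hR hd hC
  calc ‖deriv g z‖ ≤ B / ((ρ - ρ₁) / 2) := key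
    _ = 2 * B / (ρ - ρ₁) := by field_simp

/-- **`norm_deriv_deriv_le_of_segment` — THE SECOND DERIVATIVE AT THE TIP** [our proof]: `g` holomorphic on `ball 0 ρ`, `‖g‖ ≤ B`, `‖g s‖ ≤ ε` on
`[0, s₁]`, `0 < ε ≤ B`, `0 < s₁`, `s₁·cosh 1 < ρ`: for all `r, r′ ∈ ]0,1]`, with `ε′ := 25·ε^{1−r}·B^r∕((s₁∕2)·r²)` (the first-derivative rate on the
half-segment) and `B″ := 2B∕(ρ − s₁·cosh 1)` (Cauchy on `ball 0 (s₁·cosh 1)`),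
`‖deriv (deriv g) 0‖ ≤ 25·(min ε′ B″)^{1−r′}·B″^{r′} ∕ ((s₁∕2)·r′²)` — the engine applied to `deriv g` on `ball 0 (s₁·cosh 1)`. -/
theorem norm_deriv_deriv_le_of_segment (hg : DifferentiableOn ℂ g (ball (0 : ℂ) ρ)) (hB : ∀ z ∈ ball (0 : ℂ) ρ, ‖g z‖ ≤ B)
    (hε : ∀ s : ℝ, 0 ≤ s → s ≤ s₁ → ‖g (s : ℂ)‖ ≤ ε) (hs₁ : 0 < s₁) (hs₁ρ : s₁ * Real.cosh 1 < ρ) (hε0 : 0 < ε) (hεB : ε ≤ B)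
    {r r' : ℝ} (hr : 0 < r) (hr1 : r ≤ 1) (hr' : 0 < r') (hr'1 : r' ≤ 1) :
    ‖deriv (deriv g) 0‖ ≤
      25 * ((min (25 * (ε ^ (1 - r) * B ^ r) / (s₁ / 2 * r ^ 2)) (2 * B / (ρ - s₁ * Real.cosh 1))) ^ (1 - r')
        * (2 * B / (ρ - s₁ * Real.cosh 1)) ^ r') / (s₁ / 2 * r' ^ 2) := by
  have hρ : 0 < ρ := rho_pos hs₁ hs₁ρ
  have hB0 : 0 < B := hε0.trans_le hεB
  have hc1 : (1 : ℝ) ≤ Real.cosh 1 := Real.one_le_cosh 1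
  set ρ₁ : ℝ := s₁ * Real.cosh 1 with hρ₁
  have hρ₁0 : 0 < ρ₁ := mul_pos hs₁ (lt_of_lt_of_le one_pos hc1)
  -- `deriv g` is holomorphic on the big ball, bounded by `B″` on `ball 0 ρ₁`, and small on `[0, s₁∕2]`
  have hdg : DifferentiableOn ℂ (deriv g) (ball (0 : ℂ) ρ₁) :=
    ((hg.analyticOnNhd isOpen_ball).deriv.differentiableOn).mono (ball_subset_ball hs₁ρ.le)
  have hBdg : ∀ z ∈ ball (0 : ℂ) ρ₁, ‖deriv g z‖ ≤ 2 * B / (ρ - ρ₁) := fun z hz => norm_deriv_le_inner hg hB hs₁ρ hz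
  set ε' : ℝ := 25 * (ε ^ (1 - r) * B ^ r) / (s₁ / 2 * r ^ 2) with hε'
  have hε'0 : 0 < ε' := by
    have : 0 < ε ^ (1 - r) := Real.rpow_pos_of_pos hε0 _
    have : 0 < B ^ r := Real.rpow_pos_of_pos hB0 _
    positivity
  have hB''0 : 0 < 2 * B / (ρ - ρ₁) := div_pos (by linarith) (by linarith)
  have hεdg : ∀ s : ℝ, 0 ≤ s → s ≤ s₁ / 2 → ‖deriv g (s : ℂ)‖ ≤ min ε' (2 * B / (ρ - ρ₁)) := by
    intro s hs0 hs
    refine le_min (norm_deriv_le_on_half_segment hg hB hε hs₁ hs₁ρ hε0 hεB hr hr1 hs0 hs) (hBdg _ ?_)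
    rw [mem_ball_zero_iff, Complex.norm_real, Real.norm_eq_abs, abs_of_nonneg hs0]
    calc s ≤ s₁ / 2 := hs
      _ < s₁ := by linarith
      _ ≤ ρ₁ := le_mul_of_one_le_right hs₁.le hc1
  have hfit : s₁ / 2 * Real.cosh 1 < ρ₁ := by rw [hρ₁]; nlinarith
  exact norm_deriv_le_of_segment (g := deriv g) hdg hBdg hεdg (half_pos hs₁) hfit (lt_min hε'0 hB''0) (min_le_right _ _) hr' hr'1

end SecondOrder

/-! ## §4 Second order, family form: exponent `(θ^{1−r})^{1−r}` (PART 3's Landau–Kolmogorov `transfer₂` was stuck at `θ^{1∕3}`) -/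

section SecondOrderFamily

variable {F : ℕ → ℂ → ℂ} {ρ s₁ B c θ : ℝ}

/-- [folklore] on the open ball the derivative of a difference of holomorphic functions is the difference of the derivatives, as FUNCTIONS near `0`;
hence the same for the second derivative at `0`. -/
theorem deriv_deriv_sub_at_zero {F₀ F₁ : ℂ → ℂ} (hs₁ : 0 < s₁) (hs₁ρ : s₁ * Real.cosh 1 < ρ)
    (h₀ : DifferentiableOn ℂ F₀ (ball (0 : ℂ) ρ)) (h₁ : DifferentiableOn ℂ F₁ (ball (0 : ℂ) ρ)) :
    deriv (deriv fun z => F₁ z - F₀ z) 0 = deriv (deriv F₁) 0 - deriv (deriv F₀) 0 := by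
  have hρ : 0 < ρ := rho_pos hs₁ hs₁ρ
  have hmem : ball (0 : ℂ) ρ ∈ nhds (0 : ℂ) := ball_mem_nhds 0 hρ
  -- the first derivatives agree as functions on the ball
  have hEq : (deriv fun z => F₁ z - F₀ z) =ᶠ[nhds 0] fun z => deriv F₁ z - deriv F₀ z := by
    filter_upwards [hmem] with z hz
    have hz' : ball (0 : ℂ) ρ ∈ nhds z := isOpen_ball.mem_nhds hz
    exact deriv_sub (h₁.differentiableAt hz') (h₀.differentiableAt hz')
  rw [hEq.deriv_eq]
  have hd₁ : DifferentiableAt ℂ (deriv F₁) 0 := ((h₁.analyticOnNhd isOpen_ball).deriv.differentiableOn.differentiableAt hmem)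
  have hd₀ : DifferentiableAt ℂ (deriv F₀) 0 := ((h₀.analyticOnNhd isOpen_ball).deriv.differentiableOn.differentiableAt hmem)
  exact deriv_sub hd₁ hd₀

/-- **`deriv₂_step_rateω` — THE SECOND-DERIVATIVE ROW INHERITS THE VALUE RATE WITH EXPONENT `(θ^{1−r})^{1−r}`** [our proof]: under the hypotheses of
`deriv_step_rateω` with `0 < B`, for every `r ∈ ]0,1]` and every `k`,
`‖deriv (deriv (F (k+1))) 0 − deriv (deriv (F k)) 0‖ ≤ 25·A^{1−r}·B″^r∕((s₁∕2)·r²) · ((θ^{1−r})^{1−r})^k`, where `A = 25·c^{1−r}·(2B)^r∕((s₁∕2)·r²)` is the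
first-derivative rate constant on the half-segment (for the difference `F (k+1) − F k`, bound `2B`) and `B″ = 2·(2B)∕(ρ − s₁·cosh 1)` the Cauchy bound on the inner ball. -/
theorem deriv₂_step_rateω (hs₁ : 0 < s₁) (hs₁ρ : s₁ * Real.cosh 1 < ρ)
    (hF : ∀ k, DifferentiableOn ℂ (F k) (ball (0 : ℂ) ρ)) (hB : ∀ k, ∀ z ∈ ball (0 : ℂ) ρ, ‖F k z‖ ≤ B) (hB0 : 0 < B)
    (hrate : ∀ k (s : ℝ), 0 ≤ s → s ≤ s₁ → ‖F (k + 1) (s : ℂ) - F k (s : ℂ)‖ ≤ c * θ ^ k) (hc : 0 < c) (hθ : 0 < θ)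
    {r : ℝ} (hr : 0 < r) (hr1 : r ≤ 1) (k : ℕ) :
    ‖deriv (deriv (F (k + 1))) 0 - deriv (deriv (F k)) 0‖ ≤
      25 * ((25 * c ^ (1 - r) * (2 * B) ^ r / (s₁ / 2 * r ^ 2)) ^ (1 - r)
        * (2 * (2 * B) / (ρ - s₁ * Real.cosh 1)) ^ r) / (s₁ / 2 * r ^ 2) * ((θ ^ (1 - r)) ^ (1 - r)) ^ k := by
  -- the difference `g := F (k+1) − F k`: holomorphic, bound `2B`, small `min (cθ^k) (2B)` on the segment
  set g : ℂ → ℂ := fun z => F (k + 1) z - F k z with hg_def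
  have hg : DifferentiableOn ℂ g (ball (0 : ℂ) ρ) := (hF (k + 1)).sub (hF k)
  have hgB : ∀ z ∈ ball (0 : ℂ) ρ, ‖g z‖ ≤ 2 * B := fun z hz =>
    (norm_sub_le _ _).trans (by linarith [hB (k + 1) z hz, hB k z hz])
  have hεk : 0 < c * θ ^ k := mul_pos hc (pow_pos hθ k)
  have hmin0 : 0 < min (c * θ ^ k) (2 * B) := lt_min hεk (by linarith)
  have hgε : ∀ s : ℝ, 0 ≤ s → s ≤ s₁ → ‖g (s : ℂ)‖ ≤ min (c * θ ^ k) (2 * B) := fun s hs0 hs1 =>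
    le_min (hrate k s hs0 hs1) (hgB _ (by
      rw [mem_ball_zero_iff, Complex.norm_real, Real.norm_eq_abs, abs_of_nonneg hs0]
      have : s₁ ≤ s₁ * Real.cosh 1 := le_mul_of_one_le_right hs₁.le (Real.one_le_cosh 1)
      linarith))
  have key := norm_deriv_deriv_le_of_segment hg hgB hgε hs₁ hs₁ρ hmin0 (min_le_right _ _) hr hr1 hr hr1
  rw [hg_def, deriv_deriv_sub_at_zero hs₁ hs₁ρ (hF k) (hF (k + 1))] at key
  refine key.trans ?_
  -- abbreviations
  set B'' : ℝ := 2 * (2 * B) / (ρ - s₁ * Real.cosh 1) with hB''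
  set A : ℝ := 25 * c ^ (1 - r) * (2 * B) ^ r / (s₁ / 2 * r ^ 2) with hA
  set ε' : ℝ := 25 * ((min (c * θ ^ k) (2 * B)) ^ (1 - r) * (2 * B) ^ r) / (s₁ / 2 * r ^ 2) with hε'
  have h4B : 0 < (2 * B) ^ r := Real.rpow_pos_of_pos (by linarith) r
  have hB''0 : 0 < B'' := by rw [hB'']; exact div_pos (by linarith) (by linarith)
  have hB''r : 0 ≤ B'' ^ r := Real.rpow_nonneg hB''0.le r
  have hθr : 0 ≤ θ ^ (1 - r) := Real.rpow_nonneg hθ.le _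
  have hε'0 : 0 ≤ ε' := by
    have : 0 ≤ (min (c * θ ^ k) (2 * B)) ^ (1 - r) := Real.rpow_nonneg hmin0.le _
    rw [hε']; positivity
  -- (i) `ε′ ≤ A·(θ^{1−r})^k`
  have hε'le : ε' ≤ A * (θ ^ (1 - r)) ^ k := by
    have hmono : (min (c * θ ^ k) (2 * B)) ^ (1 - r) ≤ (c * θ ^ k) ^ (1 - r) :=
      Real.rpow_le_rpow hmin0.le (min_le_left _ _) (by linarith)
    calc ε' ≤ 25 * ((c * θ ^ k) ^ (1 - r) * (2 * B) ^ r) / (s₁ / 2 * r ^ 2) := by rw [hε']; gcongr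
      _ = A * (θ ^ (1 - r)) ^ k := by rw [rpow_geom hc.le hθ.le r k, hA]; ring
  -- (ii) `(min ε′ B″)^{1−r} ≤ (A·(θ^{1−r})^k)^{1−r} = A^{1−r}·((θ^{1−r})^{1−r})^k`
  have hA0 : 0 ≤ A := by
    have : 0 ≤ c ^ (1 - r) := Real.rpow_nonneg hc.le _
    rw [hA]; positivity
  have hstep : (min ε' B'') ^ (1 - r) ≤ A ^ (1 - r) * ((θ ^ (1 - r)) ^ (1 - r)) ^ k := by
    calc (min ε' B'') ^ (1 - r) ≤ ε' ^ (1 - r) := Real.rpow_le_rpow (le_min hε'0 hB''0.le) (min_le_left _ _) (by linarith)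
      _ ≤ (A * (θ ^ (1 - r)) ^ k) ^ (1 - r) := Real.rpow_le_rpow hε'0 hε'le (by linarith)
      _ = A ^ (1 - r) * ((θ ^ (1 - r)) ^ (1 - r)) ^ k := rpow_geom hA0 hθr r k
  calc 25 * ((min ε' B'') ^ (1 - r) * B'' ^ r) / (s₁ / 2 * r ^ 2)
      ≤ 25 * ((A ^ (1 - r) * ((θ ^ (1 - r)) ^ (1 - r)) ^ k) * B'' ^ r) / (s₁ / 2 * r ^ 2) := by gcongr
    _ = 25 * (A ^ (1 - r) * B'' ^ r) / (s₁ / 2 * r ^ 2) * ((θ ^ (1 - r)) ^ (1 - r)) ^ k := by ring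

/-- **`exists_deriv₂_geometricRate` — THE ∃θ-CURRENCY END, SECOND ORDER** [our proof]: a geometric one-step rate for the second-derivative row at the base
point (witness `θ″ = (θ^{1∕2})^{1∕2}` from `r = 1∕2`; any `(θ^{1−r})^{1−r}` is available from `deriv₂_step_rateω`). -/
theorem exists_deriv₂_geometricRate (hs₁ : 0 < s₁) (hs₁ρ : s₁ * Real.cosh 1 < ρ)
    (hF : ∀ k, DifferentiableOn ℂ (F k) (ball (0 : ℂ) ρ)) (hB : ∀ k, ∀ z ∈ ball (0 : ℂ) ρ, ‖F k z‖ ≤ B) (hB0 : 0 < B)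
    (hrate : ∀ k (s : ℝ), 0 ≤ s → s ≤ s₁ → ‖F (k + 1) (s : ℂ) - F k (s : ℂ)‖ ≤ c * θ ^ k) (hc : 0 < c) (hθ : 0 < θ) (hθ1 : θ < 1) :
    ∃ c'' θ'' : ℝ, 0 ≤ c'' ∧ 0 ≤ θ'' ∧ θ'' < 1 ∧ ∀ k, ‖deriv (deriv (F (k + 1))) 0 - deriv (deriv (F k)) 0‖ ≤ c'' * θ'' ^ k := by
  refine ⟨_, (θ ^ (1 - 1 / 2 : ℝ)) ^ (1 - 1 / 2 : ℝ), ?_, ?_, ?_,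
    fun k => deriv₂_step_rateω hs₁ hs₁ρ hF hB hB0 hrate hc hθ (r := 1 / 2) (by norm_num) (by norm_num) k⟩
  · have h3 : 0 ≤ (25 * c ^ (1 - 1 / 2 : ℝ) * (2 * B) ^ (1 / 2 : ℝ) / (s₁ / 2 * (1 / 2 : ℝ) ^ 2)) ^ (1 - 1 / 2 : ℝ) :=
      Real.rpow_nonneg (by have := Real.rpow_nonneg hc.le (1 - 1 / 2 : ℝ); have := Real.rpow_nonneg (by linarith : (0:ℝ) ≤ 2 * B) (1 / 2 : ℝ); positivity) _
    have h4 : 0 ≤ (2 * (2 * B) / (ρ - s₁ * Real.cosh 1)) ^ (1 / 2 : ℝ) := Real.rpow_nonneg (div_pos (by linarith) (by linarith)).le _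
    positivity
  · exact Real.rpow_nonneg (Real.rpow_nonneg hθ.le _) _
  · have h1 : θ ^ (1 - 1 / 2 : ℝ) < 1 := Real.rpow_lt_one hθ.le hθ1 (by norm_num)
    exact Real.rpow_lt_one (Real.rpow_nonneg hθ.le _) h1 (by norm_num)

end SecondOrderFamily

end Summit.QuantumFields.BalabanUV.Beta.GAN24.DerivativeRateTransferAnalytic

end
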